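import Summits.ABC.IUTFork.Repair.CandDupuyHilado32Real
import Summits.ABC.IUTFork.Cor312LicenceRealSharpMovers
import HarnessLib

/-!
# IUT REPAIR branch B, sub-cell B4 (Dupuy–Hilado), row RP-H32 — the REAL column, (Ind2) half: Dupuy–Hilado's own
# `Aut(L : I)` lattice automorphisms move the sharp Θ-boxes at EVERY label of `𝔽_l^⋇` over a tame quadratically ramified prime

PROOF-ONLY sequel (D-0012: 0 definitions, 0 `Prop` facts; abc-iut cell, IUT REPAIR branch, rung LADDER-ABC:A2.B ⊇ A2.RP, seat
abc-iut-rp-h3 gen 4) of `CandDupuyHilado32Real` (p446172: the (Ind1) half — the capsule transposition exits the class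
`CandDupuyHilado32.OrbitInside` at the genuine sharp setting as soon as two places over one prime carry Θ-ideles of different
norms; in the equal-norm regime (Ind1) fixes every Θ-region). TAKES NO SIDE on [IUTchIII] Cor. 3.12 and on no author;
`OrbitInside` is this seat's barrier class (p432805), not a Dupuy–Hilado sentence, not a candidate; typed ≠ proved;
instantiated ≠ endorsed.

THIS FILE supplies the complementary (Ind2) mover — the mechanism Dupuy–Hilado II §6.2 (6.3)–(6.7) themselves describe («Aut(L : I)
is by definition ℚ_p-linear and fixes I as a set», `book:anonnd-2004-13108v2` p.20 l.67; «multiplication by β⁻¹ will increase the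
size of the hull», l.63–64) — on the typed GENUINE data at the labels `j ∈ 𝔽_l^⋇` the class reads (the parent (Ind2) movers act at
the label `0` only: abc-iut-w4-d087 `Cor312PinnedThetaRealSharpNegativePr`, abc-iut-w5-d216 `Thm311RealIsmDHMoverAssembled`, whose
construction is followed line by line). Data: a prime `p₀ ≥ 5`, a place `v₀ | p₀` of `F` with `e(v₀|p₀) = 2`, `f(v₀|p₀) = 1`, and at
some index a Θ-idele of EVEN `ϖ`-order at `v₀` (`‖t_{Θ,i+1,v₀}‖ = ‖ϖ‖^{2k}`; a UNIT in particular — every place off `S` for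
Θ-ideles realising `P_Θ`):
* `exists_ind2_moves_thetaRegion_settingPrVolSharp` — w5-d216's parity mover (`IsmDHMover.exists_swap_parity`: fixes every
  odd-exponent ball, hence the log-shell — an element of DH's (Ind2) `Real.ismDH` — and moves every even one), placed in the LAST
  tensor factor at the summand `v₀`, identity elsewhere, is a `Φ₀ ∈ Ind2Family` NOT mapping the Θ-region of abc-iut-c312-7's
  `Thm311.Real.settingPrVolSharp` at `(i+1, p₀)` onto itself (test vectors `1 ⊗ ⋯ ⊗ 1 ⊗ y_z`; by abc-iut-c312-3 `comparison_tprod`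
  and abc-iut-w4-d087 `norm_dEquiv_purePacket` their membership in `comparison⁻¹ Π_{v⃗} ι_j(t_{Θ,j,v⃗(j)})·(R_I)^∼`
  (`CandDupuyHilado32Real.thetaRegion_settingPrVolSharp_inr`) reads `‖z‖ ≤ ‖ϖ‖^{2k}`, an even ball).
* **`not_orbitInside_settingPrVolSharp_of_ramified_even`**, **`not_orbitInside_settingPrVolSharp_of_ramified`** (Θ-ideles units off
  `S`, no place of `S` over `p₀`): `OrbitInside` FAILS at the genuine sharp setting through (Ind2) ALONE — also for `F` with one place
  over every bad prime, where the (Ind1) half holds (`CandDupuyHilado32Real.image_thetaRegion_eq_of_ind1_of_norm_const`);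
  `exists_ind2_moves_thetaRegion_settingPrVolSharp_of_not_mem` (the multiradial orbit at `(i+1, p₀)` is not a single region).

READING for the census (neutral; completes the REAL cell of RP-H32): at genuine data the orbit-barrier premise is exited through
print's (Ind1) wherever two Θ-norms differ over a prime (p446172) AND through Dupuy–Hilado's (Ind2) over every tame quadratically
ramified prime `p₀ ≥ 5` away from `S`; there `orbit_barrier_statement` does not fire, `dh_door` is open, and the residue is the
quantitative sub-row RP-H01g / branch C. HONEST SCOPE: OUR typed objects (c312-5's `logShellsDH`, DH's (Ind2) = ALL shell-preserving
bicontinuous lattice automorphisms, the SHARP (Ind3) reading); absent under the ISOMETRY reading of Ism; hypotheses as in the parent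
movers. Nothing here bears on print's (xi-e)/(xi-f) or on [IUTchIII] Cor. 3.12 itself. [cite: DupuyHilado2020, §6.2 pp. 19–20]
[cite: DupuyHilado2025, §3.9, §4.9] [cite: ScholzeStix2018, §2.2 pp. 9–10] [claim: Mochizuki2012, status: disputed]. Axioms: standard.
-/

noncomputable section

open Metric Set Function NumberField IsDedekindDomain
open scoped Pointwise

namespace Summit.ABC.IUTFork.Repair.CandDupuyHilado32RealInd2

open Thm311 Thm311.Real Cor312 Cor312Vol Literature.IUT.LogThetaLattice Literature.IUT.LogVolume
open Literature.NumberTheory.NumberFields Literature.NumberTheory.GaloisRepresentations.Ultrametric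
open Summit.ABC.IUTFork.Repair.CandDupuyHilado32 (OrbitInside)
open Summit.ABC.IUTFork.Repair.CandDupuyHilado32Real

/-! ## §1. Pure tensors in a translated normalized packet: `⊗_a w_a ∈ ι_i(c)·(R_I)^∼ ↔ Π_a ‖w_a‖ ≤ ‖c‖` -/

section Packet

variable (p : ℕ) [Fact p.Prime] {I : Type} [Fintype I] [DecidableEq I] [Nonempty I]
  (k : I → Type) [∀ i, NontriviallyNormedField (k i)] [∀ i, NormedAlgebra ℚ_[p] (k i)]
  [∀ i, IsUltrametricDist (k i)] [∀ i, ProperSpace (k i)]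

/-- **`⊗_a w_a ∈ ι_i(c)·(R_I)^∼ ↔ Π_a ‖w_a‖ ≤ ‖c‖`** (`c ≠ 0`): membership of a pure tensor in a translated normalized packet is
read on the product of the norms (w5-d216 `Ind1Mover.mem_iota_smul_normalizedPacket_iff` + w4-d087 `norm_dEquiv_purePacket`).
[cite: Mochizuki2012, IUTchIV Prop. 1.4 (i) p. 13] -/
theorem purePacket_mem_iota_smul_normalizedPacket_iff (i : I) {c : k i} (hc : c ≠ 0) (x : Π a, k a) :
    purePacket p k x ∈ iota p k i c • (normalizedPacket p k : Set (PacketAlgebra p k)) ↔ ∏ a, ‖x a‖ ≤ ‖c‖ := by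
  rw [Ind1Mover.mem_iota_smul_normalizedPacket_iff p k i hc]
  obtain ⟨j⟩ := nonempty_dIdx p k
  constructor
  · intro h
    have hj := h j
    rwa [LicenceMover.norm_dEquiv_purePacket] at hj
  · intro h j'
    rw [LicenceMover.norm_dEquiv_purePacket]
    exact h

end Packet

/-! ## §2. The (Ind2) Θ-mover at a tame quadratically ramified place, at every label of `𝔽_l^⋇` -/
section Real

variable {F : Type} [Field F] [NumberField F] (X : PilotData F)
  (M : Type) [Field M] [NumberField M]
  (archPk : ∀ (j : (thetaIndex X).Label) (vQ : (thetaIndex X).VQ),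
    Set ((logShellsDH X (analyticLogv F)).Packet j vQ))
  (archSub : ∀ (j : (thetaIndex X).Label) (v : (thetaIndex X).V),
    Set ((logShellsDH X (analyticLogv F)).Packet j ((thetaIndex X).over v)))
  (Ψ : ℤ → ∀ v : (thetaIndex X).V, v ∈ (thetaIndex X).Vbad → Set ((logShellsDH X (analyticLogv F)).StarPacket v))
  (act : ℤ → ∀ v : (thetaIndex X).V, v ∈ (thetaIndex X).Vbad →
    (logShellsDH X (analyticLogv F)).StarPacket v →
      Module.End ℚ ((logShellsDH X (analyticLogv F)).StarPacket v))
  (Mmod : ℤ → ∀ j : (thetaIndex X).LabelStar, Set ((logShellsDH X (analyticLogv F)).GlobalPacket j.1))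
  (region : ℤ → ∀ j : (thetaIndex X).LabelStar, FinDivisor M → ∀ vQ : (thetaIndex X).VQ,
    Set ((logShellsDH X (analyticLogv F)).Packet j.1 vQ))
  (n : ℤ) {HT : Type} {LogLink : HT → HT → Type} {IsFull : ∀ {s t : HT}, LogLink s t → Prop}
  (lat : LGPGaussianLogThetaLattice LogLink IsFull)
  {Frd : Type} {IsoF : Frd → Frd → Type} {Ob : Frd → Type} {realify : Frd → Frd} {Strip : Type}
  {IsoS : Strip → Strip → Type} {Mv : ∀ v : (thetaIndex X).V, v ∈ (thetaIndex X).Vbad → Type}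
  [∀ v h, Monoid (Mv v h)]
  (sig : GlobalLGPFrobenioidSignature (thetaIndex X).lstar (thetaIndex X).V (· ∈ (thetaIndex X).Vbad)
    Frd IsoF Ob realify Strip IsoS Mv)
  (split : SplittingMonoids Mv) {ObΔ : Type} {N : ∀ v : (thetaIndex X).V, v ∈ (thetaIndex X).Vbad → Type}
  [∀ v h, Monoid (N v h)] (qData : QPilotData ObΔ N)
  (t : ∀ (pp : Nat.Primes) (_ : Fin X.lstar) (x : (thetaIndex X).Fibre (.inr pp)),
    haveI : Fact (pp : ℕ).Prime := ⟨pp.2⟩; kOf X pp.1 x)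
  (tq : ∀ (pp : Nat.Primes) (x : (thetaIndex X).Fibre (.inr pp)), haveI : Fact (pp : ℕ).Prime := ⟨pp.2⟩; kOf X pp.1 x)
  (htq0 : ∀ pp x, tq pp x ≠ 0)
  (htq1 : ∀ (pp : Nat.Primes) (x : (thetaIndex X).Fibre (.inr pp)),
    haveI : Fact (pp : ℕ).Prime := ⟨pp.2⟩; placeOf X pp.1 x ∉ X.S → ‖tq pp x‖ = 1)
  (col : ℤ → Column (logShellsDH X (analyticLogv F)))

/-- **THE (Ind2) Θ-MOVER AT A LABEL OF `𝔽_l^⋇`, GENUINE DATA.** At a tame quadratically ramified place `v₀ | p₀` (`p₀ ≥ 5`,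
`e = 2`, `f = 1`) where the Θ-idele of index `i` has EVEN `ϖ`-order (`‖t_{Θ,i+1,v₀}‖ = ‖ϖ‖^{2k}`), some (Ind2)-family of the
Dupuy–Hilado instance — w5-d216's parity mover in the last tensor factor at the summand `v₀`, the identity elsewhere — does
NOT map the Θ-region of the genuine sharp setting at `(i+1, p₀)` onto itself, for any Kummer index `m` (the sharp boxes do not
read `m`). [cite: DupuyHilado2025, §3.9, §4.9] [cite: DupuyHilado2020, §6.2 pp. 19–20] -/
theorem exists_ind2_moves_thetaRegion_settingPrVolSharp (ht0 : ∀ pp i x, t pp i x ≠ 0)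
    (pp : Nat.Primes) (h5 : 5 ≤ (pp : ℕ)) (v₀ : HeightOneSpectrum (𝓞 F))
    (hv₀ : (thetaIndex X).over (.inr v₀) = .inr pp)
    (he : v₀.asIdeal.ramificationIdx ℤ = 2) (hf : v₀.asIdeal.inertiaDeg ℤ = 1)
    (ϖ : (haveI : Fact (pp : ℕ).Prime := ⟨pp.2⟩; (kOf X pp.1 ⟨.inr v₀, hv₀⟩)ˣ))
    (hϖ : haveI : Fact (pp : ℕ).Prime := ⟨pp.2⟩; IsUniformizer ϖ) (i : Fin (thetaIndex X).lstar) (k : ℤ)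
    (hti : haveI : Fact (pp : ℕ).Prime := ⟨pp.2⟩;
      ‖t pp i ⟨.inr v₀, hv₀⟩‖ = ‖(ϖ : kOf X pp.1 ⟨.inr v₀, hv₀⟩)‖ ^ (2 * k)) :
    ∃ Φ₀ ∈ (logShellsDH X (analyticLogv F)).Ind2Family, ∀ m : ℤ,
      ⇑(Φ₀ (Setting.labelSucc i) (.inr pp)) ''
          (settingPrVolSharp X (logvAnalytic_analyticLogv (F := F)) M archPk archSub Ψ act Mmod region n lat sig split
            qData tq t htq0 htq1).thetaRegion m (Setting.labelSucc i) (.inr pp) ≠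
        (settingPrVolSharp X (logvAnalytic_analyticLogv (F := F)) M archPk archSub Ψ act Mmod region n lat sig split
            qData tq t htq0 htq1).thetaRegion m (Setting.labelSucc i) (.inr pp) := by
  classical
  haveI hpF : Fact (pp : ℕ).Prime := ⟨pp.2⟩
  haveI : Fintype ((thetaIndex X).Fibre (.inr pp)) := Fintype.ofFinite _
  set K := kOf X pp.1 ⟨.inr v₀, hv₀⟩
  have hlog : LogvAnalytic (analyticLogv F) := logvAnalytic_analyticLogv (F := F)
  let L := logShellsDH X (analyticLogv F)
  set x₀ : (thetaIndex X).Fibre (.inr pp) := ⟨.inr v₀, hv₀⟩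
  set P := presAt X hlog pp
  let j : (thetaIndex X).Label := Setting.labelSucc i
  have hres : residueChar F v₀ = (pp : ℕ) := congrArg Subtype.val (Sum.inr.inj hv₀)
  have hv : ((pp : ℕ) : 𝓞 F) ∈ v₀.asIdeal := natCast_mem_placeOf X pp x₀
  have hsq : ‖(ϖ : K)‖ ^ 2 = ((pp : ℕ) : ℝ)⁻¹ := by
    have h := norm_pow_absRamificationIdx (pp : ℕ) (K) hϖ
    have he' : absRamificationIdx (pp : ℕ) (K) = 2 :=
      (absRamificationIdx_rescaledCompletion F pp v₀ hv).trans he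
    rwa [he'] at h
  have hfinrank : Module.finrank ℚ_[pp] (K) = 2 := by
    have h := RescaledCompletion.localDeg_eq_finrank F pp v₀ hv
    rw [localDeg, he, hf] at h
    exact h.symm
  obtain ⟨φK, hφc, hφc', -, hfixK, hmovK⟩ := IsmDHMover.exists_swap_parity (K := K) hsq hfinrank
  let e : Carrier (.inr v₀ : Place F) ≃+* K := RescaledCompletion.of F pp v₀ hv
  have hshell : shell (analyticLogv F) (.inr v₀) = e.symm '' closedBall (0 : K) ‖(ϖ : K)‖⁻¹ :=
    shell_analyticLogv_eq_image_closedBall (pp : ℕ) v₀ hv hres h5 he hϖ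
  let ψa : Carrier (.inr v₀ : Place F) ≃+ Carrier (.inr v₀ : Place F) :=
    (e.toAddEquiv.trans φK.toAddEquiv).trans e.symm.toAddEquiv
  let ψ : Carrier (.inr v₀ : Place F) ≃ₗ[ℚ] Carrier (.inr v₀ : Place F) :=
    { ψa with map_smul' := fun q x => map_rat_smul ψa q x }
  have hψ : ∀ x, ψ x = e.symm (φK (e x)) := fun x => rfl
  have hψimg : ∀ S : Set K, ⇑ψ '' (e.symm '' S) = e.symm '' (⇑φK '' S) := by
    intro S
    ext y
    simp only [Set.mem_image, hψ]
    constructor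
    · rintro ⟨x, ⟨z, hz, rfl⟩, rfl⟩
      exact ⟨φK z, ⟨z, hz, rfl⟩, by simp only [RingEquiv.apply_symm_apply]⟩
    · rintro ⟨w, ⟨z, hz, rfl⟩, rfl⟩
      exact ⟨e.symm z, ⟨z, hz, rfl⟩, by simp only [RingEquiv.apply_symm_apply]⟩
  have hψmem : ψ ∈ ismDH (analyticLogv F) (.inr v₀ : Place F) := by
    refine ⟨hφc, hφc', ?_⟩
    have h := hfixK 0
    rw [show (2 : ℤ) * 0 - 1 = -1 by norm_num, zpow_neg_one] at h
    rw [hshell, hψimg, h]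
  -- the ball `B_c := e⁻¹ B(0, ‖ϖ‖^{2k})` is MOVED by `ψ`
  set Bc : Set (Carrier (.inr v₀ : Place F)) := e.symm '' closedBall (0 : K) (‖(ϖ : K)‖ ^ (2 * k)) with hBc
  have hmem_Bc : ∀ z : Carrier (.inr v₀ : Place F), z ∈ Bc ↔ ‖e z‖ ≤ ‖(ϖ : K)‖ ^ (2 * k) := by
    intro z
    rw [hBc]
    constructor
    · rintro ⟨w, hw, rfl⟩
      rw [RingEquiv.apply_symm_apply]; exact mem_closedBall_zero_iff.mp hw
    · intro hz
      exact ⟨e z, mem_closedBall_zero_iff.mpr hz, e.symm_apply_apply z⟩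
  have hψBc : ⇑ψ '' Bc ≠ Bc := by
    rw [hBc, hψimg]
    intro h
    exact hmovK k (e.symm.injective.image_injective h)
  -- the place-level mover: `ψ` at `v₀`, the identity elsewhere
  let gPl : ∀ y : Place F, Carrier y ≃ₗ[ℚ] Carrier y := fun y =>
    if h : y = .inr v₀ then (by subst h; exact ψ) else LinearEquiv.refl ℚ (Carrier y)
  have hgPl_v₀ : gPl (.inr v₀) = ψ := by
    show (if h : (Sum.inr v₀ : Place F) = .inr v₀ then _ else _) = ψ
    rw [dif_pos rfl]
  have hgPl_ne : ∀ y : Place F, y ≠ .inr v₀ → gPl y = LinearEquiv.refl ℚ (Carrier y) := by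
    intro y hy
    show (if h : y = .inr v₀ then _ else _) = _
    rw [dif_neg hy]
  have hgPl_mem : ∀ y : Place F, gPl y ∈ ismDH (analyticLogv F) y := by
    intro y
    by_cases hy : y = .inr v₀
    · subst hy; rw [hgPl_v₀]; exact hψmem
    · rw [hgPl_ne y hy]; exact refl_mem_ismDH _ y
  -- the (Ind2)-generator: the place-level mover in the LAST tensor factor only (independent copies of Ism per factor)
  let gFam : ∀ (j' : (thetaIndex X).Label) (_ : (thetaIndex X).Caps j') (y : Place F), Carrier y ≃ₗ[ℚ] Carrier y :=
    fun j' a y => if a = Fin.last _ then gPl y else LinearEquiv.refl ℚ (Carrier y)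
  have hgFam_last : ∀ (j' : (thetaIndex X).Label) (y : Place F), gFam j' (Fin.last _) y = gPl y := by
    intro j' y
    show (if (Fin.last _ : (thetaIndex X).Caps j') = Fin.last _ then _ else _) = _
    rw [if_pos rfl]
  have hgFam_ne : ∀ (j' : (thetaIndex X).Label) (a : (thetaIndex X).Caps j') (y : Place F), a ≠ Fin.last _ →
      gFam j' a y = LinearEquiv.refl ℚ (Carrier y) := by
    intro j' a y ha
    show (if a = Fin.last _ then _ else _) = _
    rw [if_neg ha]
  have hgFam_mem : ∀ (j' : (thetaIndex X).Label) (a : (thetaIndex X).Caps j') (y : Place F),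
      gFam j' a y ∈ ismDH (analyticLogv F) y := by
    intro j' a y
    by_cases ha : a = Fin.last _
    · rw [ha, hgFam_last]; exact hgPl_mem y
    · rw [hgFam_ne j' a y ha]; exact refl_mem_ismDH _ y
  let Φ₀ : L.PacketAut := fun j' vQ => L.factorwise j' vQ fun a => L.summandwise vQ fun v => gFam j' a v.1
  have hΦ₀ : Φ₀ ∈ L.Ind2Family := fun j' vQ =>
    ⟨fun a v => gFam j' a v.1, fun a v => hgFam_mem j' a v.1, rfl⟩
  refine ⟨Φ₀, hΦ₀, fun m => ?_⟩
  -- the region, in the real prime packet: `comparison⁻¹ Π_{v⃗} ι_last(t_{Θ,j,v⃗ last})·(R_I)^∼`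
  rw [thetaRegion_settingPrVolSharp_inr]
  have hc0 : ∀ x : (thetaIndex X).Fibre (.inr pp), labelIdele X t pp j x ≠ 0 := fun x =>
    labelIdele_ne_zero X t ht0 pp j x
  have hck : ‖labelIdele X t pp j x₀‖ = ‖(ϖ : K)‖ ^ (2 * k) := by
    rw [show labelIdele X t pp j x₀ = t pp i x₀ from labelIdele_labelSucc X t pp i x₀]
    exact hti
  -- test vectors: the pure tensor `1 ⊗ ⋯ ⊗ 1 ⊗ y_z`, `y_z = z` at `v₀` and the label idele elsewhere
  let y1 : Carrier (.inr v₀ : Place F) → L.Packet1 (.inr pp) := fun z =>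
    Function.update (fun v => (P.φ v).symm (labelIdele X t pp j v)) x₀ z
  have hy1_x₀ : ∀ z, y1 z x₀ = z := fun z => Function.update_self _ _ _
  have hy1_ne : ∀ z (v : (thetaIndex X).Fibre (.inr pp)), v ≠ x₀ →
      y1 z v = (P.φ v).symm (labelIdele X t pp j v) :=
    fun z v hv' => Function.update_of_ne hv' _ _
  let y0 : L.Packet1 (.inr pp) := fun v => (P.φ v).symm 1
  let xf : Carrier (.inr v₀ : Place F) → (thetaIndex X).Caps j → L.Packet1 (.inr pp) := fun z =>
    Function.update (fun _ => y0) (Fin.last _) (y1 z)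
  have hxf_last : ∀ z, xf z (Fin.last _) = y1 z := fun z => Function.update_self _ _ _
  have hxf_ne : ∀ z (a : (thetaIndex X).Caps j), a ≠ Fin.last _ → xf z a = y0 :=
    fun z a ha => Function.update_of_ne ha _ _
  let xz : Carrier (.inr v₀ : Place F) → L.Packet j (.inr pp) := fun z => L.tprod j (.inr pp) (xf z)
  -- the comparison on the test vectors, summand by summand: a pure tensor whose norm product is the last factor's norm
  have hφx₀ : ∀ z : Carrier (.inr v₀ : Place F), P.φ x₀ z = e z := fun z => rfl
  have hprod : ∀ z (ev : (thetaIndex X).Caps j → (thetaIndex X).Fibre (.inr pp)),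
      ∏ a, ‖P.φ (ev a) (xf z a (ev a))‖ = ‖P.φ (ev (Fin.last _)) (y1 z (ev (Fin.last _)))‖ := by
    intro z ev
    rw [Fintype.prod_eq_single (Fin.last _) fun a ha => by
      rw [hxf_ne z a ha, LinearEquiv.apply_symm_apply, norm_one]]
    rw [hxf_last]
  have hcomp : ∀ z (ev : (thetaIndex X).Caps j → (thetaIndex X).Fibre (.inr pp)),
      P.comparison j (xz z) ev = purePacket pp.1 (P.kk ev) fun a => P.φ (ev a) (xf z a (ev a)) :=
    fun z ev => P.comparison_tprod j (xf z) ev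
  have hall : ∀ z, ‖e z‖ ≤ ‖(ϖ : K)‖ ^ (2 * k) →
      ∀ v : (thetaIndex X).Fibre (.inr pp), ‖P.φ v (y1 z v)‖ ≤ ‖labelIdele X t pp j v‖ := by
    intro z hz v
    by_cases hv' : v = x₀
    · subst hv'
      rw [hy1_x₀, hφx₀]
      exact hz.trans_eq hck.symm
    · rw [hy1_ne z v hv', LinearEquiv.apply_symm_apply]
      exact le_rfl
  have hmem_xz : ∀ z, xz z ∈ P.comparison j ⁻¹' (Set.pi univ fun ev =>
      iota pp.1 (P.kk ev) (Fin.last _) (labelIdele X t pp j (ev (Fin.last _))) •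
        (normalizedPacket pp.1 (P.kk ev) : Set (P.X ev))) ↔ z ∈ Bc := by
    intro z
    rw [hmem_Bc, Set.mem_preimage, Set.mem_univ_pi]
    constructor
    · intro h
      have h0 := h (fun _ => x₀)
      rw [hcomp, purePacket_mem_iota_smul_normalizedPacket_iff pp.1 (P.kk fun _ => x₀) (Fin.last _) (hc0 x₀),
        hprod, hy1_x₀, hφx₀] at h0
      exact h0.trans_eq hck
    · intro hz ev
      rw [hcomp, purePacket_mem_iota_smul_normalizedPacket_iff pp.1 (P.kk ev) (Fin.last _) (hc0 (ev (Fin.last _))),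
        hprod]
      exact hall z hz (ev (Fin.last _))
  -- the generator acts on the test vectors by `ψ` at `v₀` in the last factor
  have hΦxz : ∀ z, Φ₀ j (.inr pp) (xz z) = xz (ψ z) := by
    intro z
    show L.factorwise j (.inr pp) (fun a => L.summandwise (.inr pp) fun v => gFam j a v.1)
        (L.tprod j (.inr pp) (xf z)) = L.tprod j (.inr pp) (xf (ψ z))
    rw [L.factorwise_summandwise_tprod]
    congr 1
    funext a v
    by_cases ha : a = Fin.last _
    · subst ha
      rw [hxf_last, hxf_last, hgFam_last]
      by_cases hv' : v = x₀
      · rw [hv', hy1_x₀, hy1_x₀]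
        show gPl (.inr v₀) z = ψ z
        rw [hgPl_v₀]
      · have hv1 : v.1 ≠ .inr v₀ := fun h => hv' (Subtype.ext h)
        rw [hy1_ne z _ hv', hy1_ne (ψ z) _ hv', hgPl_ne v.1 hv1]
        rfl
    · rw [hxf_ne z a ha, hxf_ne (ψ z) a ha, hgFam_ne j a v.1 ha]
      rfl
  intro hEq
  have key : ∀ x, x ∈ _ ↔ Φ₀ j (.inr pp) x ∈ _ := fun x =>
    ((Φ₀ j (.inr pp)).injective.mem_set_image).symm.trans (Set.ext_iff.mp hEq (Φ₀ j (.inr pp) x))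
  rcases IsmDHMover.exists_of_image_ne ψ.toEquiv hψBc with ⟨z, hz, hψz⟩ | ⟨z, hz, hψz⟩
  · -- `z ∈ B_c`, `ψ z ∉ B_c`: `x_z` lies in the region, `Φ₀ x_z = x_{ψ z}` does not
    have h1 : Φ₀ j (.inr pp) (xz z) ∈ _ := (key (xz z)).mp ((hmem_xz z).mpr hz)
    have h2 := (hΦxz z) ▸ h1
    exact hψz ((hmem_xz (ψ z)).mp h2)
  · -- `z ∉ B_c`, `ψ z ∈ B_c`: `x_{ψ z} = Φ₀ x_z` lies in the (Φ₀-stable) region, so `x_z` does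
    have h1 : xz (ψ z) ∈ _ := (hmem_xz (ψ z)).mpr hψz
    have h2 := (hΦxz z).symm ▸ h1
    exact hz ((hmem_xz z).mp ((key (xz z)).mpr h2))

/-- **RP-H32 REAL CELL, (Ind2) half — `OrbitInside` FAILS AT THE GENUINE sharp setting through Dupuy–Hilado's (Ind2) ALONE**
whenever `F` has a tame quadratically ramified place `v₀ | p₀ ≥ 5` at which some Θ-idele has even `ϖ`-order: the (Ind2)-family
of `exists_ind2_moves_thetaRegion_settingPrVolSharp` is a generator of `⟨(Ind1) ∪ (Ind2)⟩` not mapping the Θ-region at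
`(i+1, p₀)` onto itself (`CandDupuyHilado32Real.not_orbitInside_of_image_ne`). [cite: DupuyHilado2020, §6.2 pp. 19–20]
[cite: DupuyHilado2025, §4.9] -/
theorem not_orbitInside_settingPrVolSharp_of_ramified_even (ht0 : ∀ pp i x, t pp i x ≠ 0)
    (pp : Nat.Primes) (h5 : 5 ≤ (pp : ℕ)) (v₀ : HeightOneSpectrum (𝓞 F))
    (hv₀ : (thetaIndex X).over (.inr v₀) = .inr pp)
    (he : v₀.asIdeal.ramificationIdx ℤ = 2) (hf : v₀.asIdeal.inertiaDeg ℤ = 1)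
    (ϖ : (haveI : Fact (pp : ℕ).Prime := ⟨pp.2⟩; (kOf X pp.1 ⟨.inr v₀, hv₀⟩)ˣ))
    (hϖ : haveI : Fact (pp : ℕ).Prime := ⟨pp.2⟩; IsUniformizer ϖ) (i : Fin (thetaIndex X).lstar) (k : ℤ)
    (hti : haveI : Fact (pp : ℕ).Prime := ⟨pp.2⟩;
      ‖t pp i ⟨.inr v₀, hv₀⟩‖ = ‖(ϖ : kOf X pp.1 ⟨.inr v₀, hv₀⟩)‖ ^ (2 * k)) :
    ¬ OrbitInside
        ({ toSituation := situationPrVol X (logvAnalytic_analyticLogv (F := F)) M archPk archSub Ψ act Mmod region,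
           col := col } : LatticeSituation (thetaIndex X))
        (settingPrVolSharp X (logvAnalytic_analyticLogv (F := F)) M archPk archSub Ψ act Mmod region n lat sig split qData
          tq t htq0 htq1) := by
  obtain ⟨Φ₀, hΦ₀, hmov⟩ := exists_ind2_moves_thetaRegion_settingPrVolSharp X M archPk archSub Ψ act Mmod region n lat sig
    split qData t tq htq0 htq1 ht0 pp h5 v₀ hv₀ he hf ϖ hϖ i k hti
  exact not_orbitInside_of_image_ne _ _ i (.inr pp)
    (thetaRegion3_eq_thetaRegion_settingPrVolSharp X _ M archPk archSub Ψ act Mmod region n lat sig split qData t tq htq0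
      htq1 _ _)
    (Set.mem_union_right _ hΦ₀) (hmov 0)

/-- **Units off `S`, no place of `S` over `p₀`** (abc-iut-c312-7's `ht1`, satisfied by every family realising `P_Θ`): the Θ-idele at
`v₀` is a unit (even order `0`) at every index, so some (Ind2)-family moves the Θ-region at `(i+1, p₀)` at EVERY label of `𝔽_l^⋇`.
[cite: DupuyHilado2020, §6.2 pp. 19–20] [cite: DupuyHilado2025, §3.9, §4.9] -/
theorem exists_ind2_moves_thetaRegion_settingPrVolSharp_of_not_mem (ht0 : ∀ pp i x, t pp i x ≠ 0)
    (ht1 : ∀ (pp : Nat.Primes) (i : Fin X.lstar) (x : (thetaIndex X).Fibre (.inr pp)),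
      haveI : Fact (pp : ℕ).Prime := ⟨pp.2⟩; placeOf X pp.1 x ∉ X.S → ‖t pp i x‖ = 1)
    (pp : Nat.Primes) (h5 : 5 ≤ (pp : ℕ)) (v₀ : HeightOneSpectrum (𝓞 F))
    (hv₀ : (thetaIndex X).over (.inr v₀) = .inr pp)
    (he : v₀.asIdeal.ramificationIdx ℤ = 2) (hf : v₀.asIdeal.inertiaDeg ℤ = 1)
    (hS : ∀ v ∈ X.S, residueChar F v ≠ (pp : ℕ)) (i : Fin (thetaIndex X).lstar) :
    ∃ Φ₀ ∈ (logShellsDH X (analyticLogv F)).Ind2Family, ∀ m : ℤ,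
      ⇑(Φ₀ (Setting.labelSucc i) (.inr pp)) ''
          (settingPrVolSharp X (logvAnalytic_analyticLogv (F := F)) M archPk archSub Ψ act Mmod region n lat sig split
            qData tq t htq0 htq1).thetaRegion m (Setting.labelSucc i) (.inr pp) ≠
        (settingPrVolSharp X (logvAnalytic_analyticLogv (F := F)) M archPk archSub Ψ act Mmod region n lat sig split
            qData tq t htq0 htq1).thetaRegion m (Setting.labelSucc i) (.inr pp) := by
  haveI hpF : Fact (pp : ℕ).Prime := ⟨pp.2⟩
  set x₀ : (thetaIndex X).Fibre (.inr pp) := ⟨.inr v₀, hv₀⟩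
  have hv : ((pp : ℕ) : 𝓞 F) ∈ v₀.asIdeal := natCast_mem_placeOf X pp x₀
  obtain ⟨-, ϖ₁, hϖ₁, -⟩ := exists_uniformizer_sq (pp : ℕ) v₀ hv he hf
  let ϖ : (kOf X pp.1 x₀)ˣ := ϖ₁
  have hϖ : IsUniformizer ϖ := hϖ₁
  -- no place of `S` over `p₀`: the Θ-idele at `v₀` is a unit
  have hx₀S : placeOf X pp.1 x₀ ∉ X.S := fun hmem =>
    hS _ hmem (show residueChar F v₀ = (pp : ℕ) from congrArg Subtype.val (Sum.inr.inj hv₀))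
  have hti : ‖t pp i x₀‖ = ‖(ϖ : kOf X pp.1 x₀)‖ ^ (2 * (0 : ℤ)) := by
    rw [ht1 pp i x₀ hx₀S, mul_zero, zpow_zero]
  exact exists_ind2_moves_thetaRegion_settingPrVolSharp X M archPk archSub Ψ act Mmod region n lat sig split qData t tq htq0
    htq1 ht0 pp h5 v₀ hv₀ he hf ϖ hϖ i 0 hti

/-- **RP-H32 REAL CELL — `OrbitInside` FAILS at the genuine sharp setting through Dupuy–Hilado's (Ind2) ALONE** as soon as `F` has
a tame quadratically ramified place over a prime `p₀ ≥ 5` with no place of `S` above it (Θ-ideles units off `S`) — also for `F`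
with a single place over each bad prime, where the (Ind1) half of the premise holds. [cite: DupuyHilado2020, §6.2 pp. 19–20]
[cite: DupuyHilado2025, §3.9, §4.9] -/
theorem not_orbitInside_settingPrVolSharp_of_ramified (ht0 : ∀ pp i x, t pp i x ≠ 0)
    (ht1 : ∀ (pp : Nat.Primes) (i : Fin X.lstar) (x : (thetaIndex X).Fibre (.inr pp)),
      haveI : Fact (pp : ℕ).Prime := ⟨pp.2⟩; placeOf X pp.1 x ∉ X.S → ‖t pp i x‖ = 1)
    (pp : Nat.Primes) (h5 : 5 ≤ (pp : ℕ)) (v₀ : HeightOneSpectrum (𝓞 F))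
    (hv₀ : (thetaIndex X).over (.inr v₀) = .inr pp)
    (he : v₀.asIdeal.ramificationIdx ℤ = 2) (hf : v₀.asIdeal.inertiaDeg ℤ = 1)
    (hS : ∀ v ∈ X.S, residueChar F v ≠ (pp : ℕ)) :
    ¬ OrbitInside
        ({ toSituation := situationPrVol X (logvAnalytic_analyticLogv (F := F)) M archPk archSub Ψ act Mmod region,
           col := col } : LatticeSituation (thetaIndex X))
        (settingPrVolSharp X (logvAnalytic_analyticLogv (F := F)) M archPk archSub Ψ act Mmod region n lat sig split qData
          tq t htq0 htq1) := by
  let i : Fin (thetaIndex X).lstar := ⟨0, by have := (thetaIndex X).two_le_lstar; omega⟩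
  obtain ⟨Φ₀, hΦ₀, hmov⟩ := exists_ind2_moves_thetaRegion_settingPrVolSharp_of_not_mem X M archPk archSub Ψ act Mmod region n
    lat sig split qData t tq htq0 htq1 ht0 ht1 pp h5 v₀ hv₀ he hf hS i
  exact not_orbitInside_of_image_ne _ _ i (.inr pp)
    (thetaRegion3_eq_thetaRegion_settingPrVolSharp X _ M archPk archSub Ψ act Mmod region n lat sig split qData t tq htq0
      htq1 _ _)
    (Set.mem_union_right _ hΦ₀) (hmov 0)

end Real

end Summit.ABC.IUTFork.Repair.CandDupuyHilado32RealInd2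

end
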